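import Mathlib
import Summits.ValiantsHypothesis.ValiantsHypothesis.Theses.NewtonUnitEquations
import Summits.ValiantsHypothesis.ValiantsHypothesis.Theorems.NewtonUnitEquationsDissociatedFixedKExposedWord

/-!
# `DissociatedUniform` (stmt-ValiantsHypothesis-5905) — the design reduction (negative lane, modulo `BadLevelSets`)

Conjecture K of the crux chain ("level sets of `ℤ/q`-additive weights on a dissociated cube have
polynomially many hull vertices") is LITERALLY a special case of the crux
`Summit.ValiantsHypothesis.ValiantsHypothesis.Theses.NewtonUnitEquations.DissociatedUniform`:
the CHARACTER DESIGN with `k = q` rows, `t = 2`, `A j = {0, v j}`,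
`f i j = 1 + ζ^(i·φ j) X^(v j)` (`ζ = exp(2πi/q)`) has tensor values
`T(S) = Σ_{i<q} ζ^(i·Φ(S)) = q·[q ∣ Φ(S)]`, so the support of `Σ_i Π_j f i j` is exactly the level set
`{Σ_{j∈S} v j : q ∣ Σ_{j∈S} φ j}` and the crux bounds its Newton-polygon vertices by `(q·m·2+2)^C`.
Hence a family of level sets beating every such bound (`BadLevelSets`, the construction target of the
standing disprover's N4(i) / the lead's `D-compute-c1.md`: none is known — every computed family is
LINEAR in `m`) refutes the crux:

* `dissociatedUniform_false_of_badLevelSets : BadLevelSets → ¬ DissociatedUniform`.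

[folklore: the realisability of residue designs by rank-`q` tensors via orthogonality of characters;
setting KPTT arXiv:1308.2286 §2]
-/

-- `Summit.ValiantsHypothesis.ValiantsHypothesis.…` is the tree's mandated single-conjunct layout (Sub = Summit).
set_option linter.dupNamespace false

namespace Summit.ValiantsHypothesis.ValiantsHypothesis.Theorems.DissociatedUniform.Negative

open MvPolynomial
open scoped BigOperators

noncomputable section

/-- **The construction target.**  For every exponent `C` there is a dissociated cube frame
(`v : Fin m → ℕ²` with distinct subset sums) with weights `φ : Fin m → ℕ` and a modulus `q ≥ 1` whose
level set `{Σ_{j∈S} v j : q ∣ Σ_{j∈S} φ j}` has MORE than `(q·m·2+2)^C` Newton-polygon vertices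
(extreme points of the convex hull of its planar embedding). OPEN as a construction: no such family is
known; all computed level sets have `≤ 3.3·m` vertices. -/
def BadLevelSets : Prop :=
  ∀ C : ℕ, ∃ (m q : ℕ) (v : Fin m → (Fin 2 →₀ ℕ)) (φ : Fin m → ℕ), 1 ≤ q ∧
    (∀ S T : Finset (Fin m), ∑ j ∈ S, v j = ∑ j ∈ T, v j → S = T) ∧
    (q * m * 2 + 2) ^ C <
      (Set.extremePoints ℝ (convexHull ℝ ((fun e : Fin 2 →₀ ℕ => fun i : Fin 2 => ((e i : ℕ) : ℝ)) ''
        {e : Fin 2 →₀ ℕ | ∃ S : Finset (Fin m), q ∣ ∑ j ∈ S, φ j ∧ e = ∑ j ∈ S, v j}))).ncard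

section Design

variable {m q : ℕ} (v : Fin m → (Fin 2 →₀ ℕ)) (φ : Fin m → ℕ) (ζ : ℂ)

/-- The cube frame `A j = {0, v j}`. -/
def cubeFrame (j : Fin m) : Finset (Fin 2 →₀ ℕ) := {0, v j}

/-- The character design `f i j = 1 + ζ^(i·φ j) · X^(v j)`. -/
def designPoly (i : Fin q) (j : Fin m) : MvPolynomial (Fin 2) ℂ :=
  1 + monomial (v j) (ζ ^ ((i : ℕ) * φ j))

/-- The cube frame has at most two letters per coordinate. [folklore] -/
theorem card_cubeFrame_le (j : Fin m) : (cubeFrame v j).card ≤ 2 := by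
  unfold cubeFrame
  exact Finset.card_le_two

/-- The design polynomials have support in the cube frame. [folklore] -/
theorem support_designPoly_subset (i : Fin q) (j : Fin m) :
    (designPoly v φ ζ i j).support ⊆ cubeFrame v j := by
  classical
  intro e he
  unfold designPoly at he
  have h := MvPolynomial.support_add he
  rw [Finset.mem_union] at h
  unfold cubeFrame
  rw [Finset.mem_insert, Finset.mem_singleton]
  rcases h with h | h
  · left
    rw [MvPolynomial.mem_support_iff, MvPolynomial.coeff_one] at h
    by_contra hne
    exact h (if_neg (Ne.symm hne))
  · right
    simpa using MvPolynomial.support_monomial_subset h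

variable {v}

/-- Distinct subset sums force every `v j` to be nonzero. -/
theorem v_ne_zero (hdis : ∀ S T : Finset (Fin m), ∑ j ∈ S, v j = ∑ j ∈ T, v j → S = T) (j : Fin m) :
    v j ≠ 0 := by
  intro h
  have := hdis ∅ {j} (by simp [h])
  exact absurd (this ▸ Finset.mem_singleton_self j) (Finset.notMem_empty j)

/-- Coefficient of the design polynomial at the letter `0` (for `v j ≠ 0`). [folklore] -/
theorem coeff_zero_designPoly (hv : ∀ j, v j ≠ 0) (i : Fin q) (j : Fin m) :
    coeff 0 (designPoly v φ ζ i j) = 1 := by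
  classical
  unfold designPoly
  rw [coeff_add, coeff_one, if_pos rfl, coeff_monomial, if_neg (hv j), add_zero]

/-- Coefficient of the design polynomial at the letter `v j` (for `v j ≠ 0`). [folklore] -/
theorem coeff_v_designPoly (hv : ∀ j, v j ≠ 0) (i : Fin q) (j : Fin m) :
    coeff (v j) (designPoly v φ ζ i j) = ζ ^ ((i : ℕ) * φ j) := by
  classical
  unfold designPoly
  rw [coeff_add, coeff_one, if_neg (hv j).symm, coeff_monomial, if_pos rfl, zero_add]

/-- The subset read off a cube word: `S(a) = {j : a j = v j}`. -/
def subsetOf (v : Fin m → (Fin 2 →₀ ℕ)) (a : Fin m → (Fin 2 →₀ ℕ)) : Finset (Fin m) :=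
  Finset.univ.filter fun j => a j = v j

/-- A cube word reads `v j` on its subset and `0` off it. [folklore] -/
theorem word_apply {a : Fin m → (Fin 2 →₀ ℕ)} (ha : ∀ j, a j ∈ cubeFrame v j)
    (j : Fin m) : a j = if j ∈ subsetOf v a then v j else 0 := by
  classical
  have h := ha j
  unfold cubeFrame at h
  rw [Finset.mem_insert, Finset.mem_singleton] at h
  by_cases hj : j ∈ subsetOf v a
  · rw [if_pos hj]; exact (Finset.mem_filter.mp hj).2
  · rw [if_neg hj]
    rcases h with h | h
    · exact h
    · exact absurd (Finset.mem_filter.mpr ⟨Finset.mem_univ j, h⟩) hj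

/-- The point of a cube word is the subset sum of its subset. [folklore] -/
theorem sum_word {a : Fin m → (Fin 2 →₀ ℕ)} (ha : ∀ j, a j ∈ cubeFrame v j) :
    ∑ j, a j = ∑ j ∈ subsetOf v a, v j := by
  classical
  rw [← Finset.sum_filter_add_sum_filter_not Finset.univ (fun j => j ∈ subsetOf v a)]
  have h1 : ∑ j ∈ Finset.univ.filter (fun j => j ∈ subsetOf v a), a j = ∑ j ∈ subsetOf v a, v j := by
    have : Finset.univ.filter (fun j => j ∈ subsetOf v a) = subsetOf v a := by
      ext j; simp
    rw [this]
    refine Finset.sum_congr rfl fun j hj => ?_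
    rw [word_apply ha j, if_pos hj]
  have h2 : ∑ j ∈ Finset.univ.filter (fun j => ¬ j ∈ subsetOf v a), a j = 0 := by
    refine Finset.sum_eq_zero fun j hj => ?_
    rw [Finset.mem_filter] at hj
    rw [word_apply ha j, if_neg hj.2]
  rw [h1, h2, add_zero]

/-- Tensor value of a cube word under the character design: `T(a) = Σ_i (ζ^Φ(S(a)))^i`. -/
theorem tval_word (hv : ∀ j, v j ≠ 0) {a : Fin m → (Fin 2 →₀ ℕ)} (ha : ∀ j, a j ∈ cubeFrame v j) :
    (∑ i : Fin q, ∏ j, coeff (a j) (designPoly v φ ζ i j)) =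
      ∑ i ∈ Finset.range q, (ζ ^ ∑ j ∈ subsetOf v a, φ j) ^ i := by
  classical
  have hterm : ∀ i : Fin q, ∏ j, coeff (a j) (designPoly v φ ζ i j) =
      (ζ ^ ∑ j ∈ subsetOf v a, φ j) ^ (i : ℕ) := by
    intro i
    have hprod : ∏ j, coeff (a j) (designPoly v φ ζ i j) =
        ∏ j, (if j ∈ subsetOf v a then ζ ^ ((i : ℕ) * φ j) else 1) := by
      refine Finset.prod_congr rfl fun j _ => ?_
      by_cases hj : j ∈ subsetOf v a
      · rw [if_pos hj, word_apply ha j, if_pos hj, coeff_v_designPoly φ ζ hv]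
      · rw [if_neg hj, word_apply ha j, if_neg hj, coeff_zero_designPoly φ ζ hv]
    rw [hprod, Finset.prod_ite, Finset.prod_const_one, mul_one]
    have : Finset.univ.filter (fun j => j ∈ subsetOf v a) = subsetOf v a := by ext j; simp
    rw [this, Finset.prod_pow_eq_pow_sum, ← Finset.mul_sum, pow_mul']
  calc ∑ i : Fin q, ∏ j, coeff (a j) (designPoly v φ ζ i j)
      = ∑ i : Fin q, (ζ ^ ∑ j ∈ subsetOf v a, φ j) ^ (i : ℕ) := Finset.sum_congr rfl fun i _ => hterm i
    _ = ∑ i ∈ Finset.range q, (ζ ^ ∑ j ∈ subsetOf v a, φ j) ^ i :=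
        Fin.sum_univ_eq_sum_range (fun i => (ζ ^ ∑ j ∈ subsetOf v a, φ j) ^ i) q

/-- Orthogonality of characters: `Σ_{i<q} (ζ^s)^i = q` if `q ∣ s`, else `0`. -/
theorem charSum_eq (hζ : IsPrimitiveRoot ζ q) (s : ℕ) :
    (∑ i ∈ Finset.range q, (ζ ^ s) ^ i) = if q ∣ s then (q : ℂ) else 0 := by
  by_cases hs : q ∣ s
  · rw [if_pos hs, (hζ.pow_eq_one_iff_dvd s).mpr hs]
    simp
  · rw [if_neg hs]
    have hne : ζ ^ s ≠ 1 := fun h => hs ((hζ.pow_eq_one_iff_dvd s).mp h)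
    rw [geom_sum_eq hne, ← pow_mul, mul_comm, pow_mul, hζ.pow_eq_one, one_pow, sub_self, zero_div]

/-- The word of a subset: `a_S j = v j` on `S`, `0` off `S`. -/
def wordOf (v : Fin m → (Fin 2 →₀ ℕ)) (S : Finset (Fin m)) : Fin m → (Fin 2 →₀ ℕ) :=
  fun j => if j ∈ S then v j else 0

/-- The word of a subset lies in the cube frame. [folklore] -/
theorem wordOf_mem (S : Finset (Fin m)) (j : Fin m) : wordOf v S j ∈ cubeFrame v j := by
  unfold wordOf cubeFrame
  by_cases hj : j ∈ S
  · rw [if_pos hj]; simp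
  · rw [if_neg hj]; simp

/-- The subset of the word of `S` is `S` (for `v j ≠ 0`). [folklore] -/
theorem subsetOf_wordOf (hv : ∀ j, v j ≠ 0) (S : Finset (Fin m)) : subsetOf v (wordOf v S) = S := by
  classical
  ext j
  unfold subsetOf wordOf
  simp only [Finset.mem_filter, Finset.mem_univ, true_and]
  by_cases hj : j ∈ S
  · simp [hj]
  · simp only [hj, if_false, iff_false]
    exact fun h => hv j h.symm

/-- Dissociation of the cube frame from distinct subset sums. -/
theorem dissociated_cubeFrame (hdis : ∀ S T : Finset (Fin m), ∑ j ∈ S, v j = ∑ j ∈ T, v j → S = T)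
    (a b : Fin m → (Fin 2 →₀ ℕ)) (ha : ∀ j, a j ∈ cubeFrame v j) (hb : ∀ j, b j ∈ cubeFrame v j)
    (hab : ∑ j, a j = ∑ j, b j) : a = b := by
  have hv := v_ne_zero hdis
  rw [sum_word ha, sum_word hb] at hab
  have hS := hdis _ _ hab
  funext j
  rw [word_apply ha j, word_apply hb j, hS]

/-- The support of the design's sum of products is exactly the level set `q ∣ Φ(S)`. -/
theorem support_design_eq (hq : 1 ≤ q) (hζ : IsPrimitiveRoot ζ q)
    (hdis : ∀ S T : Finset (Fin m), ∑ j ∈ S, v j = ∑ j ∈ T, v j → S = T) :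
    ((∑ i : Fin q, ∏ j, designPoly v φ ζ i j).support : Set (Fin 2 →₀ ℕ)) =
      {e : Fin 2 →₀ ℕ | ∃ S : Finset (Fin m), q ∣ ∑ j ∈ S, φ j ∧ e = ∑ j ∈ S, v j} := by
  classical
  have hv := v_ne_zero hdis
  have hsupp : ∀ (i : Fin q) (j : Fin m), (designPoly v φ ζ i j).support ⊆ cubeFrame v j :=
    fun i j => support_designPoly_subset v φ ζ i j
  have hinj := dissociated_cubeFrame (v := v) hdis
  ext e
  rw [Finset.mem_coe, Set.mem_setOf_eq]
  constructor
  · intro he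
    obtain ⟨a, ha, rfl, hne⟩ :=
      Summit.ValiantsHypothesis.Theorems.DissociatedFixedK.exists_word_of_mem_support
        (cubeFrame v) (designPoly v φ ζ) hsupp hinj he
    refine ⟨subsetOf v a, ?_, sum_word ha⟩
    rw [tval_word φ ζ hv ha, charSum_eq ζ hζ] at hne
    by_contra h
    rw [if_neg h] at hne
    exact hne rfl
  · rintro ⟨S, hS, rfl⟩
    rw [MvPolynomial.mem_support_iff]
    have hw : ∀ j, wordOf v S j ∈ cubeFrame v j := wordOf_mem S
    have key := Summit.ValiantsHypothesis.Theorems.DissociatedFixedK.coeff_sum_prod_of_dissociated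
      (cubeFrame v) (designPoly v φ ζ) hsupp hinj (wordOf v S) hw
    rw [sum_word hw, subsetOf_wordOf hv] at key
    rw [key, tval_word φ ζ hv hw, subsetOf_wordOf hv, charSum_eq ζ hζ, if_pos hS]
    exact_mod_cast (Nat.one_le_iff_ne_zero.mp hq)

end Design

/-- **The design reduction (negative lane, modulo `BadLevelSets`).**  A family of `ℤ/q`-level sets of
dissociated cubes with super-polynomially many Newton-polygon vertices refutes the crux: the character
design with `k = q` rows and `t = 2` realises each level set as the support of a sum of products on the
frame `A j = {0, v j}`, where the crux bounds the vertices by `(q·m·2+2)^C`. [folklore] -/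
theorem dissociatedUniform_false_of_badLevelSets (hbad : BadLevelSets) :
    ¬ Summit.ValiantsHypothesis.ValiantsHypothesis.Theses.NewtonUnitEquations.DissociatedUniform := by
  rintro ⟨C, hC⟩
  obtain ⟨m, q, v, φ, hq, hdis, hlt⟩ := hbad C
  have hq0 : q ≠ 0 := Nat.one_le_iff_ne_zero.mp hq
  set ζ : ℂ := Complex.exp (2 * Real.pi * Complex.I / q) with hζdef
  have hζ : IsPrimitiveRoot ζ q := Complex.isPrimitiveRoot_exp q hq0
  have h := hC q m 2 (cubeFrame v) (designPoly v φ ζ) (card_cubeFrame_le v)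
    (fun i j => support_designPoly_subset v φ ζ i j) (dissociated_cubeFrame (v := v) hdis)
  rw [support_design_eq φ ζ hq hζ hdis] at h
  exact absurd (lt_of_lt_of_le hlt h) (lt_irrefl _)

end

end Summit.ValiantsHypothesis.ValiantsHypothesis.Theorems.DissociatedUniform.Negative
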